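import Literature.MathematicalPhysics.QuantumFieldTheory.Balaban1983to89.TreeLength

/-!
# Dimock, *The renormalization group according to Balaban* I, Appendix B, proof of THEOREM `\label{cluster}`, STEP 1,
# eq. (clams) — `M d_M(Y) ≤ Σ_i M d_M(X_i) + M(n−1)` for a covering by overlapping polymers — PROVED for the cell's
# Steiner length `ℓ̃` on the `ℤ^d` carrier (two polymers with a common cube; `n` polymers along an ordered tree)

**Citation header (reproduction of PUBLISHED work; template of the Bałaban lattice Yang–Mills cell).**
J. Dimock, *The renormalization group according to Balaban I. Small fields*, Rev. Math. Phys. **25** (2013) 1330010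
(= arXiv:1108.1335v2) [Dimock2013], Appendix B, proof of THEOREM `\label{cluster}`, step 1, eq. (clams) TeX
L3246–3256 (used again in step 4, L3435–3438).  TeX line numbers refer to the arXiv source held by the cell
(`inputs/files/dimock/src/1108.1335/1108.1335.tex`).  The geometric carrier is the Bałaban-side unit
`Balaban1983to89.TreeLength` (pv22: unit cubes of `ℤ^d` in `ℝ^d` with the sup metric, polygonal graphs `List (Seg d)`
with `carrier`, `len`, Steiner-admissibility `SAdmissible`, the Steiner length `steinerLen` = `ℓ̃`) — a geometry unit,
no statement of any Bałaban paper.  Dimock's papers are published and refereed and are the cell's TEMPLATE, not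
manuscripts under audit.

**What the paper prints (verbatim).**  L3246–3256: *"Next we claim that if ∪_{i=1}^n X_i = Y as above, then M d_M(Y)
≤ Σ_{i=1}^n M d_M(X_i) + M(n−1) Indeed let τ_i be a minimal tree on X_i of length Md_M(X_i) Also consider the connected
graph whose edges are pairs {X_i, X_j} such that X_i ∩ X_j ≠ ∅. Take a tree which is a subgraph with (n−1) edges. Each
pair {X_i, X_j} in this tree will have a block □ in common. For each pair add a line in □ joining the point in τ_i to
the point in τ_j. This line has length at most M. The tree graph consisting of the τ_i and the (n−1) extra lines now
joins all the blocks in Y and has length less than Σ_{i=1}^n Md_M(X_i) + M(n−1). The minimal tree must have shorter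
length which is the claim."*

**What is reproduced here (kernel-checked, zero `sorry`).**  The printed mechanism for the cell's Steiner length
(`M = 1`): `sAdmissible_join_common` — Steiner-admissible graphs for `A` and `B` with a common cube `c` glue, by ONE
segment inside `c` (sup-length `≤ 1`, `TreeLength.dist_le_one_of_mem_cube`), to a Steiner-admissible graph for `B ∪
A` of length `≤ len T_B + len T_A + 1` (the Steiner twin of pv22's `TreeLength.admissible_join_common`);
**`steinerLen_union_le`** — `ℓ̃(A ∪ B) ≤ ℓ̃(A) + ℓ̃(B) + 1` whenever `A`, `B` share a cube (approximating graphs,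
`exists_lt_of_csInf_lt`); **`steinerLen_biUnion_range_le`** — (clams) in the ORDERED form in which the overlap tree is
used: for `Z_0, …, Z_n` with every `Z_j` (`j ≥ 1`) sharing a cube with some earlier `Z_i` (`i < j`), `ℓ̃(⋃_j Z_j) ≤ Σ_j
ℓ̃(Z_j) + n` (induction on `n`).  The unordered printed form — *"Take a tree which is a subgraph"* of the connected
overlap graph — follows by relabelling the tree so that parents precede children ([Dimock2013] L3450 *"After
relabeling"*, kernel in `TreeGraphSummation.exists_relabel`); that step and the use of (clams) in step 4's decay
extraction are taken in the sibling `TreeGraphSummationLattice` (not here, to keep this leaf a pure geometry leaf).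

**Readings (declared).**  (i) `d_M` is read as the cell's Steiner length `ℓ̃` (infimum over connected polygonal graphs
meeting every cube; pv22 convention D-pv22.1, `SteinerLengthSums` DEVIATIONS); Dimock's *"shortest tree in X joining
the M-cubes in X"* also requires the tree to lie in `X` — the same gluing works verbatim for pv22's `treeLen` (the
`Admissible` class, `admissible_join_common` already in `TreeLength`), not restated.  (ii) `M = 1`, sup metric
([Dimock2013BalabanII] App. E convention, as in `TreeLength`).  (iii) The minimal trees of the print are replaced by
`ε`-approximating admissible graphs (the infimum need not be attained in the class; immaterial for the inequality).

**What is NOT claimed.**  The connected-overlap-graph form as such (see above); anything about the torus; anything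
of B1–B16.  NOT summit progress; NOT a statement about any Bałaban paper; NOT continuum field theory; NOT Clay.
Imports only `…Balaban1983to89.TreeLength` (which imports `B13ScaleTransfer` for `Pt d`; it does not import this
file; no cycle; no Summits import); sub-namespace `…Dimock2011to13.SteinerLengthUnionBound`; modifies nothing.  Unit
`b2b-balaban-template` gen 33 round 5 (journal CLAIM D1-CLAMS-KERNEL); cell records TEMPLATE.md §4.1 row «D1 §4.6»,
§15.2; GAPS C-tmpl33-7.

**Version.**  v1 (unit `b2b-balaban-template` gen 33 round 5).
-/

noncomputable section

open Finset
open Literature.MathematicalPhysics.QuantumFieldTheory.Balaban1983to89.B13ScaleTransfer (Pt)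
open Literature.MathematicalPhysics.QuantumFieldTheory.Balaban1983to89.TreeLength

namespace Literature.MathematicalPhysics.QuantumFieldTheory.Dimock2011to13.SteinerLengthUnionBound

variable {d : ℕ}

/-- Steiner-admissible graphs of length within `ε` of `ℓ̃(Y)` exist for `Y ≠ ∅`. [folklore] -/
private theorem exists_sAdmissible_len_lt {Y : Finset (Pt d)} (hY : Y.Nonempty) {ε : ℝ} (hε : 0 < ε) :
    ∃ T, SAdmissible Y T ∧ len T < steinerLen Y + ε := by
  obtain ⟨T₀, hT₀⟩ := exists_sAdmissible hY
  obtain ⟨ℓ, ⟨T, hT, rfl⟩, hlt⟩ :=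
    exists_lt_of_csInf_lt (s := slengths Y) ⟨len T₀, T₀, hT₀, rfl⟩ (lt_add_of_pos_right _ hε)
  exact ⟨T, hT, hlt⟩

/-- **JOIN THROUGH A COMMON CUBE** (the mechanism of (clams), L3250–3256: *"Each pair {X_i, X_j} in this tree will
have a block □ in common. For each pair add a line in □ joining the point in τ_i to the point in τ_j. This line has
length at most M."*): Steiner-admissible graphs for `A` and for `B`, with a cube `c` common to `A` and `B`, glue —
by one segment inside the cube `c`, of sup-length `≤ 1` — to a Steiner-admissible graph for `B ∪ A` of length `≤
len T_B + len T_A + 1` (the Steiner analogue of pv22's `TreeLength.admissible_join_common`).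
[cite: Dimock2013, App. B Theorem cluster, proof step 1 eq. (clams) (arXiv:1108.1335v2 TeX L3246–3256)] -/
theorem sAdmissible_join_common {A B : Finset (Pt d)} {TA TB : List (Seg d)} (hA : SAdmissible A TA)
    (hB : SAdmissible B TB) {c : Pt d} (hcA : c ∈ A) (hcB : c ∈ B) :
    ∃ T, SAdmissible (B ∪ A) T ∧ len T ≤ len TB + len TA + 1 := by
  obtain ⟨p, hpT, hpc⟩ := hA.meets c hcA
  obtain ⟨q, hqT, hqc⟩ := hB.meets c hcB
  refine ⟨TB ++ ((q, p) :: TA), ⟨?_, ?_⟩, ?_⟩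
  · rw [carrier_append, carrier_cons]
    refine IsConnected.union ⟨q, hqT, Set.mem_union_left _ (left_mem_segment ℝ q p)⟩ hB.connected ?_
    exact IsConnected.union ⟨p, right_mem_segment ℝ q p, hpT⟩
      ((convex_segment q p).isConnected ⟨q, left_mem_segment ℝ q p⟩) hA.connected
  · intro x hx
    rw [carrier_append, carrier_cons]
    rcases Finset.mem_union.1 hx with hx | hx
    · obtain ⟨r, hr, hrx⟩ := hB.meets x hx
      exact ⟨r, Set.mem_union_left _ hr, hrx⟩
    · obtain ⟨r, hr, hrx⟩ := hA.meets x hx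
      exact ⟨r, Set.mem_union_right _ (Set.mem_union_right _ hr), hrx⟩
  · rw [len_append, len_cons]
    change len TB + (dist q p + len TA) ≤ len TB + len TA + 1
    linarith [dist_le_one_of_mem_cube hqc hpc]

/-- **(clams) FOR TWO POLYMERS**: if `A` and `B` have a cube in common, `ℓ̃(A ∪ B) ≤ ℓ̃(A) + ℓ̃(B) + 1` (`M = 1`;
*"The minimal tree must have shorter length which is the claim"*, L3256).
[cite: Dimock2013, App. B Theorem cluster, proof step 1 eq. (clams) (arXiv:1108.1335v2 TeX L3246–3256)] -/
theorem steinerLen_union_le {A B : Finset (Pt d)} {c : Pt d} (hcA : c ∈ A) (hcB : c ∈ B) :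
    steinerLen (A ∪ B) ≤ steinerLen A + steinerLen B + 1 := by
  refine le_of_forall_pos_lt_add fun ε hε => ?_
  obtain ⟨TA, hTA, hlA⟩ := exists_sAdmissible_len_lt ⟨c, hcA⟩ (half_pos hε)
  obtain ⟨TB, hTB, hlB⟩ := exists_sAdmissible_len_lt ⟨c, hcB⟩ (half_pos hε)
  obtain ⟨T, hT, hlen⟩ := sAdmissible_join_common hTA hTB hcA hcB
  rw [Finset.union_comm] at hT
  calc steinerLen (A ∪ B) ≤ len T := steinerLen_le_len hT
    _ < steinerLen A + steinerLen B + 1 + ε := by linarith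

/-- **(clams)** (L3246–3249: *"Next we claim that if ∪_{i=1}^n X_i = Y as above, then M d_M(Y) ≤ Σ_{i=1}^n M d_M(X_i) +
M(n−1)"*; proof L3250–3256 via a tree in the overlap graph), in the ORDERED form in which the tree is used: for
non-empty cube polymers `Z_0, …, Z_{n−1}` (`n ≥ 1`) such that every `Z_j`, `j ≥ 1`, has a cube in common with some
earlier `Z_i`, `i < j` — i.e. the tuple is compatible with a tree graph relabelled so that `τ(j) < j` — the Steiner
length of the union is at most `Σ_j ℓ̃(Z_j) + (n − 1)`; induction on `n` by `steinerLen_union_le`.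
[cite: Dimock2013, App. B Theorem cluster, proof step 1 eq. (clams) (arXiv:1108.1335v2 TeX L3246–3256)] -/
theorem steinerLen_biUnion_range_le (Z : ℕ → Finset (Pt d)) :
    ∀ n : ℕ, (∀ j, 0 < j → j < n + 1 → ∃ i < j, ¬ Disjoint (Z j) (Z i)) →
      steinerLen ((Finset.range (n + 1)).biUnion Z) ≤ ∑ j ∈ Finset.range (n + 1), steinerLen (Z j) + n := by
  intro n
  induction n with
  | zero =>
    intro _
    simp
  | succ n ih =>
    intro hlink
    have ih' := ih fun j hj hjn => hlink j hj (Nat.lt_succ_of_lt hjn)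
    obtain ⟨i, hi, hZi⟩ := hlink (n + 1) (Nat.succ_pos n) (Nat.lt_succ_self _)
    obtain ⟨c, hcn, hci⟩ := Finset.not_disjoint_iff.1 hZi
    have hcU : c ∈ (Finset.range (n + 1)).biUnion Z :=
      Finset.mem_biUnion.2 ⟨i, Finset.mem_range.2 hi, hci⟩
    rw [Finset.range_add_one, Finset.biUnion_insert, Finset.sum_insert Finset.notMem_range_self]
    calc steinerLen (Z (n + 1) ∪ (Finset.range (n + 1)).biUnion Z)
        ≤ steinerLen (Z (n + 1)) + steinerLen ((Finset.range (n + 1)).biUnion Z) + 1 := steinerLen_union_le hcn hcU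
      _ ≤ steinerLen (Z (n + 1)) + (∑ j ∈ Finset.range (n + 1), steinerLen (Z j) + n) + 1 := by linarith
      _ = steinerLen (Z (n + 1)) + ∑ j ∈ Finset.range (n + 1), steinerLen (Z j) + ((n + 1 : ℕ) : ℝ) := by
          push_cast; ring

end Literature.MathematicalPhysics.QuantumFieldTheory.Dimock2011to13.SteinerLengthUnionBound
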